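import Literature.Analysis.SegalBargmann.SchrodingerSchwartzBridge
import Literature.RepresentationTheory.HeisenbergGroup.LocalWeilProjective
import Literature.RepresentationTheory.HeisenbergGroup.SchrodingerModel
import HarnessLib

/-!
# The archimedean Schrödinger model on Schwartz space as a representation of the polarised Heisenberg group, and the dictionary `Implements ↔ IsPhaseCovariantS` (Folland 1989 §1.3; MVW Chap. 2 II.1)

Topic `Analysis/SegalBargmann`; namespace `Literature.Analysis.SegalBargmann`.  This file joins two landed
developments:

* the tree's Heisenberg-group formalism (`RepresentationTheory/HeisenbergGroup`): `Heisenberg (polar β)`, Weil's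
  pseudosymplectic group, `symplecticGroup`, the section `ofSymplectic`, MVW's condition (A) `Implements ρ s M`, the group
  `MpPsi ρ` of a model `ρ`, and the function-level Schrödinger model `schrodinger β ψ` on `X → ℂ`;
* the Segal–Bargmann files of this topic: Folland's operators `rhoS p q` on `𝓢(ℝ^σ)` (T11 `SchrodingerSchwartzBridge`),
  their `L²` versions `rho p q`, and the rigidity theorems (T9 `SchrodingerCovariantUniqueness`, T4, T5).

Contents (everything PROVED, no cited statement used as a hypothesis):

* §1 the dot pairing `dotPairing σ : ℝ^σ →ₗ ℝ^σ →ₗ ℝ` and the real Heisenberg group `HeisR σ := Heisenberg (polar (dotPairing σ))`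
  (law `((p,q),t)((p′,q′),t′) = ((p+p′,q+q′), t+t′+p·q′)`);
* §2 **`schwartzSchrodinger σ : Representation ℂ (HeisR σ) 𝓢(ℝ^σ, ℂ)`**, `(ρ((p,q),t) f)(u) = e^{2πi(t + u·q)} f(u+p)`
  (`schwartzSchrodinger_apply`), i.e. the function-level tree model `schrodinger (dotPairing σ) 𝐞` restricted to Schwartz
  functions (`coe_schwartzSchrodinger`), with `ψ_∞ = 𝐞 = e^{2πi·}` (Mathlib `Real.fourierChar`); relation to Folland's
  symmetric operators: `ρ((p,q),t) = 𝐞(t − ½ p·q) • rhoS p q` (`schwartzSchrodinger_eq_smul_rhoS`), `rhoS p q = ρ((p,q), ½ p·q)`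
  (`rhoS_eq_schwartzSchrodinger`); the centre acts by `𝐞` (`schwartzSchrodinger_center`);
* §3 **the dictionary**: for `g ∈ Sp(ℝ^σ × ℝ^σ)` and `M ∈ GL(𝓢)`, MVW's condition (A) through Weil's section,
  `Implements (schwartzSchrodinger σ) (ofSymplectic g) M`, is EQUIVALENT to phase-free covariance of Folland's operators,
  `∀ p q f, M (rhoS p q f) = rhoS (g(p,q)).1 (g(p,q)).2 (M f)` (`implements_ofSymplectic_iff`) — the `½(B(gw,gw) − B(w,w))`
  of `ofSymplectic` is exactly absorbed by the symmetric normalisation; hence for families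
  `(∀ h, Implements … (ofSymplectic (ι h)) (ωS h)) ↔ IsPhaseCovariantS (h ↦ ⇑(ι h)) ωS` (`implements_family_iff`);
* §4 rigidity in MVW's language: two implementers of the same `g` which are restrictions of unitaries of `L²` differ by a
  unimodular scalar (`implements_eq_unitSmul_of_liftsTo` — the unitary form of "M est unique à un scalaire près"), and two
  implementing FAMILIES over the same `ι : H → Sp` with multiplicative unitary lifts differ by the continuous character
  `relChar` (`implements_family_eq_relChar_smul`).

Use (pub-hodgecm model cell, W3-B → W2-∞(γ)): the owner of `ωinf` states (w2) as membership in `MpPsi (schwartzSchrodinger σ)`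
(after transporting its carrier `𝓢(X_∞)` to `𝓢(ℝ^σ)`); §3 turns it into the hypothesis of T11/T9/T4.

Conventions.  `ψ_∞ = 𝐞(s) = e^{+2πis}`; a model normalised with `e^{−2πis}` is reached by `q ↦ −q`.

## References

* [Folland1989] G. B. Folland, *Harmonic Analysis in Phase Space*, Princeton University Press, 1989, §1.3 (1.25) and
  the polarised form (1.22)–(1.24); §4.2 (4.23).
* [MoeglinVignerasWaldspurger1987] C. Mœglin, M.-F. Vignéras, J.-L. Waldspurger, *Correspondances de Howe sur un corps
  p-adique*, LNM 1291, Chap. 2 I.4 Exemple (1), II.1 (A).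
-/

noncomputable section

open MeasureTheory Complex SchwartzMap
open scoped InnerProductSpace ComplexConjugate Real FourierTransform

namespace Literature.Analysis.SegalBargmann

open Literature.RepresentationTheory.HeisenbergGroup

variable (σ : Type*) [Fintype σ] [DecidableEq σ]

local notation "L2R" σ => Lp ℂ 2 (volume : Measure (σ → ℝ))
local notation "SR" σ => SchwartzMap (σ → ℝ) ℂ

/-! ## 1. The dot pairing and the real polarised Heisenberg group -/

omit [DecidableEq σ] in
/-- The dot pairing `β(x, y) = x · y = Σ_k x_k y_k` on `ℝ^σ` (a readable alias of Mathlib's `dotProductBilin ℝ ℝ`). [folklore] -/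
abbrev dotPairing : (σ → ℝ) →ₗ[ℝ] (σ → ℝ) →ₗ[ℝ] ℝ := dotProductBilin ℝ ℝ

omit [DecidableEq σ] in
/-- `dotPairing σ x y = x ⬝ᵥ y`. [folklore] -/
@[simp] theorem dotPairing_apply (x y : σ → ℝ) : dotPairing σ x y = x ⬝ᵥ y := rfl

/-- The real polarised Heisenberg group of `ℝ^σ × ℝ^σ` with the dot pairing:
`((p,q),t)((p′,q′),t′) = ((p+p′, q+q′), t + t′ + p·q′)`. [cite: MoeglinVignerasWaldspurger1987, Chap. 2 I.1] -/
abbrev HeisR := Heisenberg (polar (dotPairing σ))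

/-! ## 2. The Schrödinger representation on `𝓢(ℝ^σ)` -/

omit [DecidableEq σ] in
/-- `𝐞(s) = exp(2πis)` in the shape of `rhoMul`. [folklore] -/
theorem fourierChar_coe (s : ℝ) : ((𝐞 s : Circle) : ℂ) = cexp (((2 * π * s : ℝ) : ℂ) * I) := rfl

omit [DecidableEq σ] in
/-- The phase bookkeeping between polarised and symmetric coordinates:
`𝐞(t − ½ p·q) · e^{2πi q·u + πi p·q} = 𝐞(t + u·q)`. [folklore] -/
theorem fourierChar_mul_rhoMul (p q u : σ → ℝ) (t : ℝ) :
    ((𝐞 (t - 2⁻¹ * (p ⬝ᵥ q)) : Circle) : ℂ) * rhoMul p q u = ((𝐞 (t + u ⬝ᵥ q) : Circle) : ℂ) := by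
  rw [fourierChar_coe, fourierChar_coe, rhoMul, ← Complex.exp_add]
  congr 1
  have hqu : ∑ k, q k * u k = u ⬝ᵥ q := by rw [dotProduct_comm]; rfl
  have hpq : ∑ k, p k * q k = p ⬝ᵥ q := rfl
  rw [hqu, hpq]
  push_cast
  ring

/-- The Schrödinger operator of `h = ((p,q),t)` on `𝓢(ℝ^σ)`: `𝐞(t − ½ p·q) • ρ(p,q)` (a continuous linear operator).
[cite: Folland1989, (1.25)] -/
def schwartzSchrodingerCLM (h : HeisR σ) : (SR σ) →L[ℂ] SR σ :=
  (((𝐞 (h.t - 2⁻¹ * (h.v.1 ⬝ᵥ h.v.2)) : Circle) : ℂ)) • rhoS h.v.1 h.v.2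

omit [DecidableEq σ] in
/-- Pointwise formula: `(ρ((p,q),t) f)(u) = 𝐞(t + u·q) f(u + p)`. [cite: MoeglinVignerasWaldspurger1987, Chap. 2 I.4 Exemple (1)] -/
@[simp] theorem schwartzSchrodingerCLM_apply (h : HeisR σ) (f : SR σ) (u : σ → ℝ) :
    schwartzSchrodingerCLM σ h f u = ((𝐞 (h.t + u ⬝ᵥ h.v.2) : Circle) : ℂ) * f (u + h.v.1) := by
  show (((𝐞 (h.t - 2⁻¹ * (h.v.1 ⬝ᵥ h.v.2)) : Circle) : ℂ)) * rhoS h.v.1 h.v.2 f u = _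
  rw [rhoS_apply, ← mul_assoc, fourierChar_mul_rhoMul]

omit [DecidableEq σ] in
/-- **Junction with the tree's function-level model**: on Schwartz functions, `schwartzSchrodingerCLM` IS
`schrodinger (dotPairing σ) 𝐞`. [cite: MoeglinVignerasWaldspurger1987, Chap. 2 I.4 Exemple (1)] -/
theorem coe_schwartzSchrodingerCLM (h : HeisR σ) (f : SR σ) :
    ⇑(schwartzSchrodingerCLM σ h f) = schrodinger (dotPairing σ) 𝐞 h ⇑f := by
  funext u
  rw [schwartzSchrodingerCLM_apply, schrodinger_apply, dotPairing_apply]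

/-- **The Schrödinger representation of the real Heisenberg group on Schwartz space.**
[cite: MoeglinVignerasWaldspurger1987, Chap. 2 I.4 Exemple (1)] -/
def schwartzSchrodinger : Representation ℂ (HeisR σ) (SR σ) where
  toFun h := (schwartzSchrodingerCLM σ h : (SR σ) →ₗ[ℂ] SR σ)
  map_one' := by
    apply LinearMap.ext
    intro f
    apply SchwartzMap.ext
    intro u
    have h1 := congrFun (coe_schwartzSchrodingerCLM σ 1 f) u
    rw [map_one] at h1
    exact h1
  map_mul' a b := by
    apply LinearMap.ext
    intro f
    apply SchwartzMap.ext
    intro u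
    show schwartzSchrodingerCLM σ (a * b) f u = schwartzSchrodingerCLM σ a (schwartzSchrodingerCLM σ b f) u
    rw [coe_schwartzSchrodingerCLM, coe_schwartzSchrodingerCLM, coe_schwartzSchrodingerCLM, map_mul]
    rfl

omit [DecidableEq σ] in
/-- Unfolding. [folklore] -/
theorem schwartzSchrodinger_apply_eq (h : HeisR σ) (f : SR σ) :
    schwartzSchrodinger σ h f = schwartzSchrodingerCLM σ h f := rfl

omit [DecidableEq σ] in
/-- Pointwise formula for the representation. [cite: MoeglinVignerasWaldspurger1987, Chap. 2 I.4 Exemple (1)] -/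
@[simp] theorem schwartzSchrodinger_apply (h : HeisR σ) (f : SR σ) (u : σ → ℝ) :
    schwartzSchrodinger σ h f u = ((𝐞 (h.t + u ⬝ᵥ h.v.2) : Circle) : ℂ) * f (u + h.v.1) :=
  schwartzSchrodingerCLM_apply σ h f u

omit [DecidableEq σ] in
/-- On Schwartz functions the representation is the tree's `schrodinger (dotPairing σ) 𝐞`.
[cite: MoeglinVignerasWaldspurger1987, Chap. 2 I.4 Exemple (1)] -/
theorem coe_schwartzSchrodinger (h : HeisR σ) (f : SR σ) :
    ⇑(schwartzSchrodinger σ h f) = schrodinger (dotPairing σ) 𝐞 h ⇑f :=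
  coe_schwartzSchrodingerCLM σ h f

omit [DecidableEq σ] in
/-- **Polarised vs symmetric coordinates**: `ρ((p,q),t) f = 𝐞(t − ½ p·q) • rhoS p q f`. [cite: Folland1989, (1.25)] -/
theorem schwartzSchrodinger_eq_smul_rhoS (h : HeisR σ) (f : SR σ) :
    schwartzSchrodinger σ h f = (((𝐞 (h.t - 2⁻¹ * (h.v.1 ⬝ᵥ h.v.2)) : Circle) : ℂ)) • rhoS h.v.1 h.v.2 f := rfl

omit [DecidableEq σ] in
/-- `rhoS p q = ρ((p,q), ½ p·q)`. [cite: Folland1989, (1.25)] -/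
theorem rhoS_eq_schwartzSchrodinger (p q : σ → ℝ) (f : SR σ) :
    rhoS p q f = schwartzSchrodinger σ ⟨(p, q), 2⁻¹ * (p ⬝ᵥ q)⟩ f := by
  rw [schwartzSchrodinger_eq_smul_rhoS, sub_self, AddChar.map_zero_eq_one, Circle.coe_one, one_smul]

omit [DecidableEq σ] in
/-- The centre acts by `ψ_∞ = 𝐞`. [cite: MoeglinVignerasWaldspurger1987, Chap. 2 I.4 Exemple (1)] -/
theorem schwartzSchrodinger_center (t : ℝ) (f : SR σ) :
    schwartzSchrodinger σ ⟨0, t⟩ f = ((𝐞 t : Circle) : ℂ) • f := by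
  apply SchwartzMap.ext
  intro u
  rw [schwartzSchrodinger_apply]
  show _ = ((𝐞 t : Circle) : ℂ) * f u
  simp

/-! ## 3. The dictionary `Implements (ofSymplectic g) ↔` phase-free covariance of `rhoS` -/

omit [DecidableEq σ] in
/-- The central correction of Weil's section cancels in symmetric coordinates:
`(ofSymplectic g) · ((p,q), ½ p·q) = (g(p,q), ½ p′·q′)`. [folklore] -/
theorem ofSymplectic_act_half (g : symplecticGroup (polar (dotPairing σ))) (p q : σ → ℝ) :
    (ofSymplectic _ g).act (⟨(p, q), 2⁻¹ * (p ⬝ᵥ q)⟩ : HeisR σ) =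
      ⟨g.1 (p, q), 2⁻¹ * ((g.1 (p, q)).1 ⬝ᵥ (g.1 (p, q)).2)⟩ := by
  apply Heisenberg.ext
  · rfl
  · rw [Heisenberg.PseudoSymplectic.act_t, ofSymplectic_f, polar_apply, polar_apply, dotPairing_apply,
      dotPairing_apply, invOf_eq_inv]
    show 2⁻¹ * (p ⬝ᵥ q) + 2⁻¹ * ((g.1 (p, q)).1 ⬝ᵥ (g.1 (p, q)).2 - p ⬝ᵥ q) = 2⁻¹ * ((g.1 (p, q)).1 ⬝ᵥ (g.1 (p, q)).2)
    ring

omit [DecidableEq σ] in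
/-- General elements: `(ofSymplectic g) · ((p,q),t)` has central part `t + ½(p′·q′ − p·q)`. [folklore] -/
theorem ofSymplectic_act (g : symplecticGroup (polar (dotPairing σ))) (h : HeisR σ) :
    (ofSymplectic _ g).act h = ⟨g.1 h.v, h.t + 2⁻¹ * ((g.1 h.v).1 ⬝ᵥ (g.1 h.v).2 - h.v.1 ⬝ᵥ h.v.2)⟩ := by
  apply Heisenberg.ext
  · rfl
  · rw [Heisenberg.PseudoSymplectic.act_t, ofSymplectic_f, polar_apply, polar_apply, dotPairing_apply,
      dotPairing_apply, invOf_eq_inv]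

omit [DecidableEq σ] in
/-- **MVW's condition (A) through Weil's section = phase-free covariance of Folland's operators.**
[cite: MoeglinVignerasWaldspurger1987, Chap. 2 II.1 (A)] -/
theorem implements_ofSymplectic_iff (g : symplecticGroup (polar (dotPairing σ))) (M : (SR σ) ≃ₗ[ℂ] SR σ) :
    Implements (schwartzSchrodinger σ) (ofSymplectic _ g) M ↔
      ∀ (p q : σ → ℝ) (f : SR σ), M (rhoS p q f) = rhoS (g.1 (p, q)).1 (g.1 (p, q)).2 (M f) := by
  constructor
  · intro hM p q f
    rw [rhoS_eq_schwartzSchrodinger, hM, ofSymplectic_act_half, ← rhoS_eq_schwartzSchrodinger]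
  · intro hc h f
    rw [schwartzSchrodinger_eq_smul_rhoS, map_smul, hc, ofSymplectic_act, schwartzSchrodinger_eq_smul_rhoS]
    congr 3
    show h.t - 2⁻¹ * (h.v.1 ⬝ᵥ h.v.2) =
      h.t + 2⁻¹ * ((g.1 h.v).1 ⬝ᵥ (g.1 h.v).2 - h.v.1 ⬝ᵥ h.v.2) - 2⁻¹ * ((g.1 (h.v.1, h.v.2)).1 ⬝ᵥ (g.1 (h.v.1, h.v.2)).2)
    rw [Prod.mk.eta]
    ring

variable {H : Type*}

omit [DecidableEq σ] in
/-- **Family version**: a family `ωS` of automorphisms of `𝓢(ℝ^σ)` satisfies (A) over `ofSymplectic ∘ ι` iff it is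
`IsPhaseCovariantS` over the linear phase-space action of `ι`. [cite: MoeglinVignerasWaldspurger1987, Chap. 2 II.1 (A)] -/
theorem implements_family_iff (ι : H → symplecticGroup (polar (dotPairing σ))) (ωS : H → ((SR σ) ≃ₗ[ℂ] SR σ)) :
    (∀ h, Implements (schwartzSchrodinger σ) (ofSymplectic _ (ι h)) (ωS h)) ↔
      IsPhaseCovariantS (fun h => ⇑((ι h).1 : ((σ → ℝ) × (σ → ℝ)) ≃ₗ[ℝ] ((σ → ℝ) × (σ → ℝ))))
        (fun h => ((ωS h : (SR σ) ≃ₗ[ℂ] SR σ) : (SR σ) →ₗ[ℂ] SR σ)) := by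
  simp only [implements_ofSymplectic_iff]
  rfl

omit [DecidableEq σ] in
/-- Membership in `MpPsi`, read through the dictionary. [cite: MoeglinVignerasWaldspurger1987, Chap. 2 II.1 (A)] -/
theorem mem_MpPsi_iff (g : symplecticGroup (polar (dotPairing σ))) (M : (SR σ) ≃ₗ[ℂ] SR σ) :
    (g, M) ∈ MpPsi (schwartzSchrodinger σ) ↔
      ∀ (p q : σ → ℝ) (f : SR σ), M (rhoS p q f) = rhoS (g.1 (p, q)).1 (g.1 (p, q)).2 (M f) := by
  rw [← implements_ofSymplectic_iff]
  rfl

/-! ## 4. Rigidity in MVW's language -/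

/-- **"M est unique à un scalaire près", unitary form**: two implementers of the same `g` on `𝓢(ℝ^σ)` that are
restrictions of unitaries of `L²(ℝ^σ)` differ by a unimodular scalar.
[cite: MoeglinVignerasWaldspurger1987, Chap. 2 II.1 (A)] -/
theorem implements_eq_unitSmul_of_liftsTo {g : symplecticGroup (polar (dotPairing σ))}
    {M M' : (SR σ) ≃ₗ[ℂ] SR σ} {U U' : (L2R σ) ≃ₗᵢ[ℂ] L2R σ}
    (hM : Implements (schwartzSchrodinger σ) (ofSymplectic _ g) M)
    (hM' : Implements (schwartzSchrodinger σ) (ofSymplectic _ g) M')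
    (hU : LiftsTo (M : (SR σ) →ₗ[ℂ] SR σ) (U.toContinuousLinearEquiv : (L2R σ) →L[ℂ] L2R σ))
    (hU' : LiftsTo (M' : (SR σ) →ₗ[ℂ] SR σ) (U'.toContinuousLinearEquiv : (L2R σ) →L[ℂ] L2R σ)) :
    ∃ c : ℂ, ‖c‖ = 1 ∧ ∀ f : SR σ, M' f = c • M f := by
  -- one-element families over `Unit`
  have hS : IsPhaseCovariantS (σ := σ) (H := Unit) (fun _ => ⇑(g.1 : ((σ → ℝ) × (σ → ℝ)) ≃ₗ[ℝ] _))
      (fun _ => (M : (SR σ) →ₗ[ℂ] SR σ)) :=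
    (implements_family_iff σ (fun _ : Unit => g) (fun _ => M)).1 (fun _ => hM)
  have hS' : IsPhaseCovariantS (σ := σ) (H := Unit) (fun _ => ⇑(g.1 : ((σ → ℝ) × (σ → ℝ)) ≃ₗ[ℝ] _))
      (fun _ => (M' : (SR σ) →ₗ[ℂ] SR σ)) :=
    (implements_family_iff σ (fun _ : Unit => g) (fun _ => M')).1 (fun _ => hM')
  have hω : IsPhaseCovariant (fun _ : Unit => ⇑(g.1 : ((σ → ℝ) × (σ → ℝ)) ≃ₗ[ℝ] _)) (fun _ : Unit => U) :=
    hS.lift (ω := fun _ => U) (fun _ => hU)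
  have hω' : IsPhaseCovariant (fun _ : Unit => ⇑(g.1 : ((σ → ℝ) × (σ → ℝ)) ≃ₗ[ℝ] _)) (fun _ : Unit => U') :=
    hS'.lift (ω := fun _ => U') (fun _ => hU')
  refine ⟨relCoeff (fun _ : Unit => U) (fun _ : Unit => U') (), hω.norm_relCoeff hω' (), fun f => ?_⟩
  apply toL2_injective
  have h1 : toL2 (M' f) = U' (toL2 f) := by simpa using hU' f
  have h2 : toL2 (M f) = U (toL2 f) := by simpa using hU f
  rw [h1, map_smul, h2]
  exact hω.eq_smul hω' () (toL2 f)

/-- **Family rigidity**: two families implementing the SAME `ι : H → Sp` (condition (A) through Weil's section) and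
restricting multiplicative unitary families of `L²` differ by the continuous unitary character `relChar` of T9:
`ωS′ h f = relChar h • ωS h f`. [cite: Folland1989, §4.2, (4.23) and the Schur remark following it] -/
theorem implements_family_eq_relChar_smul [Group H] {ι : H → symplecticGroup (polar (dotPairing σ))}
    {ωS ωS' : H → ((SR σ) ≃ₗ[ℂ] SR σ)} {ω ω' : H → ((L2R σ) ≃ₗᵢ[ℂ] L2R σ)}
    (hA : ∀ h, Implements (schwartzSchrodinger σ) (ofSymplectic _ (ι h)) (ωS h))
    (hA' : ∀ h, Implements (schwartzSchrodinger σ) (ofSymplectic _ (ι h)) (ωS' h))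
    (hlift : ∀ h, LiftsTo ((ωS h : (SR σ) ≃ₗ[ℂ] SR σ) : (SR σ) →ₗ[ℂ] SR σ) (liftCLM ω h))
    (hlift' : ∀ h, LiftsTo ((ωS' h : (SR σ) ≃ₗ[ℂ] SR σ) : (SR σ) →ₗ[ℂ] SR σ) (liftCLM ω' h))
    (hω1 : ∀ f : L2R σ, ω 1 f = f) (hω1' : ∀ f : L2R σ, ω' 1 f = f)
    (hωm : ∀ (h h' : H) (f : L2R σ), ω (h * h') f = ω h (ω h' f))
    (hωm' : ∀ (h h' : H) (f : L2R σ), ω' (h * h') f = ω' h (ω' h' f)) (h : H) (f : SR σ) :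
    ωS' h f = (((relChar (((implements_family_iff σ ι ωS).1 hA).lift hlift)
      (((implements_family_iff σ ι ωS').1 hA').lift hlift') hω1 hω1' hωm hωm' h : Circle) : ℂ)) • ωS h f :=
  IsPhaseCovariantS.eq_relChar_smul ((implements_family_iff σ ι ωS).1 hA) ((implements_family_iff σ ι ωS').1 hA')
    hlift hlift' hω1 hω1' hωm hωm' h f

end Literature.Analysis.SegalBargmann
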